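import Literature.NumberTheory.LFunctions.DirichletLTruncationCertificatesMean
import HarnessLib

/-!
# Truncation certificates with ROOT TRACKING — the same certificates, decided several times faster

Topic `Literature/NumberTheory/LFunctions`; namespace `Literature.NumberTheory.LFunctions.LTruncationCert`
(continues `DirichletLTruncationCertificates{,Odd,Mean}.lean`).  Small computable definitions (`rootStep`,
`rootStart`, `loopR`, `cellsR`, `certOKR`, `certDriftOKR`, `certMeanOKR`) and THEOREMS; no named fact, no `sorry`.
Cell `parity-realchar` (kernel floor of the wide column), prover seat g9.

## What and why

In the cell walk `loop` of `DirichletLTruncationCertificates.lean` every term `n` recomputes the integer root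
`⌊2^P n^{−1/(2J)}⌋` by a bisection of `P + 2` steps (`rootEnc`); measured on the farm this bisection is the
dominant cost of a certificate (kernel time linear in `P`: at `q = 2999`, `J = 1`: `P = 32`: 47.8 s, `24`: 37.4 s,
`16`: 29.3 s, `12`: 23.6 s).  Since `n ↦ ⌊2^P n^{−1/k}⌋` is non-increasing, the root of the term `n + 1` is found
from the root `r` of the term `n` by a DOWNWARD search (`rootStep`: first `r' ≤ r` with `r'^k (n+1) ≤ 2^{kP}`),
one check per term plus `⌊2^P T^{−1/k}⌋ − ⌊2^P N₀^{−1/k}⌋` decrements in total when started after `T` terms (all `2^P`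
of them from `T = 0`: cheap for `P ≤ 12`, prohibitive for `P = 32` — hence the TWO-PHASE cells `cellsR`: bisection
for the first `T` terms, tracking afterwards, `T` a free parameter chosen by the generator).  The walk `loopR`
computes THE SAME LIST as `loop` (`loop_eq_loopR`: the bisection returns exactly `(⌊·⌋, ⌊·⌋ + 1)` — `rootEnc_snd` —
and the floor root is characterised by `r^k n ≤ 2^{kP} < (r+1)^k n` — `root_unique`), so the checkers `certOKR` /
`certDriftOKR` / `certMeanOKR` (`certOK` / `certDriftOK` / `certMeanOK` with `cellsR` in place of the `loop` cells)
are EQUAL to them as Booleans for `T ≤ N₀` (`certOKR_eq`, `certDriftOKR_eq`, `certMeanOKR_eq`) and inherit their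
soundness theorems verbatim: a range file proves `certOK v q J P = true` by
`(certOKR_eq v q J P (T := T) (by decide)).symm.trans (by decide +kernel)`.  Nothing analytic is touched; measured
gain at `q = 2999`, `(J, P) = (1, 12)`, `T = 0`: 23.6 s → 16.4 s per one-certificate file (the remaining cost is the
cell and character arithmetic).
[cite: Chua2005RealZeros, §2.2 ALGO 1]

## References

* K. S. Chua, *Real zeros of Dedekind zeta functions of real quadratic fields*, Math. Comp. 74 (2005)
  1457–1470, §2.2 ALGO 1. [Chua2005RealZeros]
-/

namespace Literature.NumberTheory.LFunctions

namespace LTruncationCert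

open FeketePolyaKernel

/-! ### Definitions -/

/-- `rootStep n k P fuel r`: the largest `r' ≤ r` with `r'^k · n ≤ (2^P)^k`, by downward search (`fuel > r`
suffices). [folklore] -/
def rootStep (n k P : ℕ) : ℕ → ℕ → ℕ
  | 0, r => r
  | fuel + 1, r => if r ^ k * n ≤ (2 ^ P) ^ k then r else rootStep n k P fuel (r - 1)

/-- The root to start a walk after `t` terms: `2^P` before the first term, else the bisection root of `t`. [folklore] -/
def rootStart (t k P : ℕ) : ℕ := if t = 0 then 2 ^ P else (rootEnc t k P).1

/-- The cell walk of `loop` with the root TRACKED downward from term to term (state: the current root `r`). [folklore] -/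
def loopR (v : ℕ → ℤ) (q J P : ℕ) : ℕ → ℕ → ℕ → List (ℤ × ℕ) → List (ℤ × ℕ)
  | 0, _, _, cells => cells
  | fuel + 1, t, r, cells =>
    loopR v q J P fuel (t + 1) (rootStep (t + 1) (2 * J) P (r + 1) r)
      (cellStep (v (t + 1)) (t + 1) q (2 ^ P) (rootStep (t + 1) (2 * J) P (r + 1) r)
        (rootStep (t + 1) (2 * J) P (r + 1) r + 1) cells
        (encPow (rootStep (t + 1) (2 * J) P (r + 1) r) (rootStep (t + 1) (2 * J) P (r + 1) r + 1) (2 ^ P) J).1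
        (encPow (rootStep (t + 1) (2 * J) P (r + 1) r) (rootStep (t + 1) (2 * J) P (r + 1) r + 1) (2 ^ P) J).2)

/-- The cells of a certificate of length `N₀`, computed in TWO PHASES: bisection roots (`loop`) for the first `T`
terms, root tracking (`loopR`) from the root of `T` for the remaining `N₀ − T` terms.  Equal to
`loop v N₀ J P N₀ 0 _` for every `T ≤ N₀` (`cellsR_eq`); the generator picks `T` minimising the kernel time
(the tracking phase costs one check per term plus `⌊2^P T^{−1/(2J)}⌋` decrements in total — so `T = 0`, i.e. pure
tracking from `2^P`, is right for small `P` only). [folklore] -/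
def cellsR (v : ℕ → ℤ) (N₀ J P T : ℕ) : List (ℤ × ℕ) :=
  loopR v N₀ J P (N₀ - T) T (rootStart T (2 * J) P) (loop v N₀ J P T 0 (List.replicate J ((0 : ℤ), (0 : ℕ))))

/-- `certOK` with the two-phase walk (`T ≤ q`). [cite: Chua2005RealZeros, §2.2 ALGO 1] -/
def certOKR (v : ℕ → ℤ) (q J P T : ℕ) : Bool :=
  let su := sums v q 0 0 0 0
  let cells := cellsR v q J P T
  let ρ := (rootEnc q (2 * J) P).1
  let r := isqrtSucc q
  decide (7 ≤ q) && decide (0 < J) && decide (su.1 = 0) && decide (su.2.1 = 0) && decide (0 < r) &&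
    cells.all (fun c ↦ decide (0 ≤ c.1) &&
      decide (2 * J * (2 ^ P * 2 ^ P) * su.2.2 + 2 * (q + 1) * r * c.2 <
        2 * (2 * J) * (q + 1) * r * c.1.toNat * ρ))

/-- `certDriftOK` with the two-phase walk (`T ≤ Kq`). [cite: Chua2005RealZeros, §2.2 ALGO 1] -/
def certDriftOKR (v : ℕ → ℤ) (q K J P T : ℕ) : Bool :=
  let N₀ := K * q
  let su := sumsNeg v q 0 0 0 0
  let cells := cellsR v N₀ J P T
  let ρ := (rootEnc N₀ (2 * J) P).1
  let r := isqrtSucc N₀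
  decide (7 ≤ q) && decide (1 ≤ K) && decide (0 < J) && decide (0 ≤ su.2.1) && decide (0 < r) &&
    cells.all (fun c ↦ decide (0 ≤ c.1) &&
      decide (2 * J * (2 ^ P * 2 ^ P) * su.2.2 + 2 * (N₀ + 1) * r * c.2 <
        2 * (2 * J) * (N₀ + 1) * r * c.1.toNat * ρ))

/-- `certMeanOK` with the two-phase walk (`T ≤ Kq`). [cite: Chua2005RealZeros, §2.2 ALGO 1] -/
def certMeanOKR (v : ℕ → ℤ) (q K J P T : ℕ) : Bool :=
  let N₀ := K * q
  let Uq := (sums v q 0 0 0 0).2.1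
  let Bn := sumsMean v q Uq q 0 0 0 0
  let cells := cellsR v N₀ J P T
  let es := (List.range J).map (fun j ↦ (enc (N₀ + 1) J P (J + j + 1)).1)
  let ρ := (rootEnc N₀ (2 * J) P).1
  let r := isqrtSucc N₀
  decide (7 ≤ q) && decide (1 ≤ K) && decide (0 < J) && decide (0 ≤ Uq) && decide (0 < r) &&
    (cells.zip es).all (fun ce ↦
      decide (((2 * J * (2 ^ P * 2 ^ P) * Bn + 2 * q * r * (N₀ + 1) * ce.1.2 : ℕ) : ℤ) <
        (2 * (2 * J) * q * r * (N₀ + 1) : ℕ) * (if 0 ≤ ce.1.1 then ce.1.1 * ρ else ce.1.1 * 2 ^ P) +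
          ((2 * (2 * J) * r * (N₀ + 1) * 2 ^ P : ℕ) : ℤ) * Uq * ce.2))

/-! ### The bisection returns an interval of width one -/

/-- The bisection invariant (private copy of the companion file's lemma). [folklore] -/
private theorem bisect_spec₃ (pred : ℕ → Bool) : ∀ (fuel xl xh : ℕ), pred xl = true → pred xh = false →
    pred (bisect pred fuel xl xh).1 = true ∧ pred (bisect pred fuel xl xh).2 = false := by
  intro fuel
  induction fuel with
  | zero => intro xl xh h1 h2; exact ⟨h1, h2⟩
  | succ fuel ih =>
    intro xl xh h1 h2
    simp only [bisect]
    split_ifs with hlt hmid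
    · exact ih _ _ hmid h2
    · exact ih _ _ h1 (by simpa using hmid)
    · exact ⟨h1, h2⟩

/-- With enough fuel the bisection ends on an interval of width exactly one. [folklore] -/
private theorem bisect_width (pred : ℕ → Bool) : ∀ (fuel xl xh : ℕ), xl < xh → xh - xl ≤ 2 ^ fuel →
    (bisect pred fuel xl xh).2 = (bisect pred fuel xl xh).1 + 1 := by
  intro fuel
  induction fuel with
  | zero => intro xl xh h1 h2; simp only [bisect, pow_zero] at h2 ⊢; omega
  | succ fuel ih =>
    intro xl xh h1 h2
    rw [pow_succ] at h2
    simp only [bisect]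
    split_ifs with hlt hmid
    · exact ih _ _ (by omega) (by omega)
    · exact ih _ _ (by omega) (by omega)
    · omega

/-- `rootEnc n k P = (lo, lo + 1)`. [folklore] -/
private theorem rootEnc_snd (n k P : ℕ) : (rootEnc n k P).2 = (rootEnc n k P).1 + 1 := by
  unfold rootEnc
  refine bisect_width _ _ _ _ (Nat.succ_pos _) ?_
  have h4 : 2 ^ (P + 2) = 2 ^ P * 4 := by rw [pow_add]; norm_num
  have h1 : 1 ≤ 2 ^ P := Nat.one_le_two_pow
  rw [h4, Nat.sub_zero]
  omega

/-- The bisection root is the FLOOR root: `lo^k n ≤ (2^P)^k < (lo+1)^k n` (`n, k ≥ 1`). [folklore] -/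
private theorem rootEnc_floor {n k : ℕ} (P : ℕ) (hn : 1 ≤ n) (hk : 1 ≤ k) :
    (rootEnc n k P).1 ^ k * n ≤ (2 ^ P) ^ k ∧ (2 ^ P) ^ k < ((rootEnc n k P).1 + 1) ^ k * n := by
  have hk0 : k ≠ 0 := by omega
  have h0 : rootPred n k P 0 = true := by simp [rootPred, zero_pow hk0]
  have h1 : rootPred n k P (2 ^ P + 1) = false := by
    simp only [rootPred, decide_eq_false_iff_not, not_le]
    calc (2 ^ P) ^ k < (2 ^ P + 1) ^ k := Nat.pow_lt_pow_left (by omega) hk0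
      _ = (2 ^ P + 1) ^ k * 1 := (mul_one _).symm
      _ ≤ (2 ^ P + 1) ^ k * n := Nat.mul_le_mul_left _ hn
  obtain ⟨hlo, hhi⟩ := bisect_spec₃ (rootPred n k P) (P + 2) 0 (2 ^ P + 1) h0 h1
  have hw := rootEnc_snd n k P
  unfold rootEnc at hw
  rw [hw] at hhi
  simp only [rootPred, decide_eq_true_eq, decide_eq_false_iff_not, not_le] at hlo hhi
  exact ⟨hlo, hhi⟩

/-- The floor root is unique: `r^k n ≤ (2^P)^k < (r+1)^k n` forces `r = (rootEnc n k P).1`. [folklore] -/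
private theorem root_unique {n k P r : ℕ} (hn : 1 ≤ n) (hk : 1 ≤ k) (h1 : r ^ k * n ≤ (2 ^ P) ^ k)
    (h2 : (2 ^ P) ^ k < (r + 1) ^ k * n) : r = (rootEnc n k P).1 := by
  obtain ⟨hlo, hhi⟩ := rootEnc_floor P hn hk
  set lo := (rootEnc n k P).1
  rcases Nat.lt_trichotomy r lo with hlt | heq | hgt
  · exfalso
    have : (r + 1) ^ k * n ≤ lo ^ k * n := Nat.mul_le_mul_right _ (Nat.pow_le_pow_left (by omega) k)
    omega
  · exact heq
  · exfalso
    have : (lo + 1) ^ k * n ≤ r ^ k * n := Nat.mul_le_mul_right _ (Nat.pow_le_pow_left (by omega) k)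
    omega

/-! ### The downward search finds the floor root -/

/-- Invariant of `rootStep`: started at `r` with `(2^P)^k < (r+1)^k n` and `fuel > r`, it returns the floor root
(`k ≥ 1`). [folklore] -/
private theorem rootStep_spec (n k P : ℕ) (hk : 1 ≤ k) : ∀ (fuel r : ℕ), r < fuel → (2 ^ P) ^ k < (r + 1) ^ k * n →
    (rootStep n k P fuel r) ^ k * n ≤ (2 ^ P) ^ k ∧ (2 ^ P) ^ k < (rootStep n k P fuel r + 1) ^ k * n := by
  intro fuel
  induction fuel with
  | zero => intro r hr; omega
  | succ fuel ih =>
    intro r hr hup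
    simp only [rootStep]
    split_ifs with h
    · exact ⟨h, hup⟩
    · have hr0 : r ≠ 0 := by
        rintro rfl
        exact h (by rw [zero_pow (by omega), zero_mul]; exact Nat.zero_le _)
      refine ih (r - 1) (by omega) ?_
      rw [show r - 1 + 1 = r by omega]
      exact not_le.mp h

/-- `rootStep` from a valid upper root equals the bisection root (`n, k ≥ 1`). [folklore] -/
private theorem rootStep_eq {n k P r : ℕ} (hn : 1 ≤ n) (hk : 1 ≤ k) (hup : (2 ^ P) ^ k < (r + 1) ^ k * n) :
    rootStep n k P (r + 1) r = (rootEnc n k P).1 := by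
  obtain ⟨h1, h2⟩ := rootStep_spec n k P hk (r + 1) r (by omega) hup
  exact root_unique hn hk h1 h2

/-- `enc` in terms of the floor root alone. [folklore] -/
private theorem enc_eq (n J P m : ℕ) :
    enc n J P m = encPow (rootEnc n (2 * J) P).1 ((rootEnc n (2 * J) P).1 + 1) (2 ^ P) m := by
  rw [enc, rootEnc_snd]

/-! ### The two walks agree -/

/-- **`loopR = loop`** from any valid root state: if `(2^P)^{2J} < (r+1)^{2J} (t+1)` then the root-tracking walk from
`(t, r)` computes the same cells as `loop` from `t` (`J ≥ 1`). [cite: Chua2005RealZeros, §2.2 ALGO 1] -/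
theorem loopR_eq_loop (v : ℕ → ℤ) (q J P : ℕ) (hJ : 1 ≤ J) : ∀ (fuel t r : ℕ) (cells : List (ℤ × ℕ)),
    (2 ^ P) ^ (2 * J) < (r + 1) ^ (2 * J) * (t + 1) →
      loopR v q J P fuel t r cells = loop v q J P fuel t cells := by
  intro fuel
  induction fuel with
  | zero => intro t r cells _; rfl
  | succ fuel ih =>
    intro t r cells hup
    have hk : 1 ≤ 2 * J := by omega
    have hr : rootStep (t + 1) (2 * J) P (r + 1) r = (rootEnc (t + 1) (2 * J) P).1 :=
      rootStep_eq (by omega) hk hup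
    simp only [loopR, loop]
    rw [hr, ← enc_eq, ← rootEnc_snd]
    refine ih (t + 1) _ _ ?_
    have h2 := (rootEnc_floor P (show 1 ≤ t + 1 by omega) hk).2
    calc (2 ^ P) ^ (2 * J) < ((rootEnc (t + 1) (2 * J) P).1 + 1) ^ (2 * J) * (t + 1) := h2
      _ ≤ ((rootEnc (t + 1) (2 * J) P).1 + 1) ^ (2 * J) * (t + 1 + 1) := Nat.mul_le_mul_left _ (by omega)

/-- `rootStart t` is a valid root state after `t` terms (`J ≥ 1`). [folklore] -/
private theorem rootStart_valid (t J P : ℕ) (hJ : 1 ≤ J) :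
    (2 ^ P) ^ (2 * J) < (rootStart t (2 * J) P + 1) ^ (2 * J) * (t + 1) := by
  have hk : 1 ≤ 2 * J := by omega
  unfold rootStart
  split_ifs with ht
  · subst ht
    rw [zero_add, mul_one]
    exact Nat.pow_lt_pow_left (by omega) (by omega)
  · have h2 := (rootEnc_floor P (show 1 ≤ t by omega) hk).2
    exact lt_of_lt_of_le h2 (Nat.mul_le_mul_left _ (by omega))

/-- **`loop = loopR` started from `rootStart`** — in particular from `(0, 2^P)` (`J ≥ 1`). [cite: Chua2005RealZeros, §2.2 ALGO 1] -/
theorem loop_eq_loopR (v : ℕ → ℤ) (q J P : ℕ) (hJ : 1 ≤ J) (fuel t : ℕ) (cells : List (ℤ × ℕ)) :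
    loop v q J P fuel t cells = loopR v q J P fuel t (rootStart t (2 * J) P) cells :=
  (loopR_eq_loop v q J P hJ fuel t _ cells (rootStart_valid t J P hJ)).symm

/-- Fuel additivity of the bisection walk `loop`. [cite: Chua2005RealZeros, §2.2 ALGO 1] -/
theorem loop_append_fuel (v : ℕ → ℤ) (q J P : ℕ) : ∀ (f₁ f₂ t : ℕ) (c : List (ℤ × ℕ)),
    loop v q J P (f₁ + f₂) t c = loop v q J P f₂ (t + f₁) (loop v q J P f₁ t c) := by
  intro f₁
  induction f₁ with
  | zero => intro f₂ t c; simp [loop]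
  | succ f₁ ih =>
    intro f₂ t c
    rw [show f₁ + 1 + f₂ = (f₁ + f₂) + 1 by ring]
    simp only [loop]
    rw [ih, show t + 1 + f₁ = t + (f₁ + 1) by ring]

/-- **The two-phase cells are the cells of `loop`** (`T ≤ N₀`, `J ≥ 1`). [cite: Chua2005RealZeros, §2.2 ALGO 1] -/
theorem cellsR_eq (v : ℕ → ℤ) (N₀ J P : ℕ) {T : ℕ} (hT : T ≤ N₀) (hJ : 1 ≤ J) :
    cellsR v N₀ J P T = loop v N₀ J P N₀ 0 (List.replicate J ((0 : ℤ), (0 : ℕ))) := by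
  rw [cellsR, ← loop_eq_loopR _ _ _ _ hJ]
  have h := loop_append_fuel v N₀ J P T (N₀ - T) 0 (List.replicate J ((0 : ℤ), (0 : ℕ)))
  rw [Nat.zero_add, Nat.add_sub_cancel' hT] at h
  exact h.symm

/-! ### The checkers agree -/

/-- **`certOKR = certOK`** (`T ≤ q`). [cite: Chua2005RealZeros, §2.2 ALGO 1] -/
theorem certOKR_eq (v : ℕ → ℤ) (q J P : ℕ) {T : ℕ} (hT : T ≤ q) : certOKR v q J P T = certOK v q J P := by
  by_cases hJ : 1 ≤ J
  · simp only [certOKR, certOK, cellsR_eq v q J P hT hJ]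
  · have h0 : decide (0 < J) = false := by simp; omega
    simp only [certOKR, certOK, h0, Bool.and_false, Bool.false_and]

/-- **`certDriftOKR = certDriftOK`** (`T ≤ Kq`). [cite: Chua2005RealZeros, §2.2 ALGO 1] -/
theorem certDriftOKR_eq (v : ℕ → ℤ) (q K J P : ℕ) {T : ℕ} (hT : T ≤ K * q) :
    certDriftOKR v q K J P T = certDriftOK v q K J P := by
  by_cases hJ : 1 ≤ J
  · simp only [certDriftOKR, certDriftOK, cellsR_eq v (K * q) J P hT hJ]
  · have h0 : decide (0 < J) = false := by simp; omega
    simp only [certDriftOKR, certDriftOK, h0, Bool.and_false, Bool.false_and]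

/-- **`certMeanOKR = certMeanOK`** (`T ≤ Kq`). [cite: Chua2005RealZeros, §2.2 ALGO 1] -/
theorem certMeanOKR_eq (v : ℕ → ℤ) (q K J P : ℕ) {T : ℕ} (hT : T ≤ K * q) :
    certMeanOKR v q K J P T = certMeanOK v q K J P := by
  by_cases hJ : 1 ≤ J
  · simp only [certMeanOKR, certMeanOK, cellsR_eq v (K * q) J P hT hJ]
  · have h0 : decide (0 < J) = false := by simp; omega
    simp only [certMeanOKR, certMeanOK, h0, Bool.and_false, Bool.false_and]

end LTruncationCert

end Literature.NumberTheory.LFunctions
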